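import Literature.AnabelianGeometry.EtaleTheta.GalSectDotCCuspOfStructureGroupIso
import Literature.AnabelianGeometry.EtaleTheta.GalSectCuspCyclotomicInertia
import Literature.AnabelianGeometry.EtaleTheta.GalSectKxHatInjective
import Literature.AnabelianGeometry.AbsoluteAnabelian.ZHatCompletionFreeProcyclic
import HarnessLib

/-!
# Census of C7e clause (2): NO identification of structure groups `(K^×)^∧ ≅ Ker(res)` exists at a cusp with CENTRAL inertia
# — `Ker(res)` is torsion-free there while `(K^×)^∧ ∋ η(−1)` has order 2 (proof-only)

S. Mochizuki, *Galois sections in absolute anabelian geometry* [GalSect], Nagoya Math. J. **179** (2005), §4 p. 33 («the splittings …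
form a torsor over `H¹(G_K, Ẑ(1)) ≅ (K^×)^∧`») [cite: MochizukiGalSect2005, §4 p.33]; J. Neukirch, *Algebraic Number Theory*, Ch. II
Prop. (5.7) (`K^× ≅ ℤ × 𝒪_K^×`, so `K^× ↪ (K^×)^∧`) [cite: NeukirchANT1999, Ch. II Prop. (5.7)]; Neukirch–Schmidt–Wingberg,
*Cohomology of Number Fields*, I §2 (crossed homomorphisms; for a trivial action `H¹(H, A) = Hom(H, A)`)
[cite: NeukirchSchmidtWingberg2008, I §2 and II §7]; S. Mochizuki, [EtTh] Thm. 1.10 (iii) p. 30 [cite: MochizukiEtTh2009, Thm 1.10 (iii) p.30].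

abc-iut cell, layer L2, seat abc-iut-w5-d029 (gen 6); census item C7e (abc-iut-L2-lead R404), clause (2) «the `(K^×)^∧`-torsor of
`DotCCusp` IS the genuine `H¹`-torsor» = `MuTwoSetting.DotCCusp.IsGenuineTorsor` (p454786) = the binder (gen) of the v3 END-KNIT closers
of EtTh:Thm1.10(iii) (abc-iut-w5-d062, p451194).  PROOF-ONLY (no definition, no instance, no `Prop` fact):

* `ContH1.eq_one_of_pow_eq_one_of_conjNormal_eq` — **`H¹(H, A)` is torsion-free when `H` acts TRIVIALLY on a torsion-free `A`**
  (cocycles are continuous homomorphisms, coboundaries are trivial);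
* `GalSect.CuspPair.contH1_eq_one_of_pow_eq_one` — for a cuspidal pair `(D, I)` with `I ≅ Ẑ` CENTRAL in `D`, every class of
  `H¹(D, I)` killed by `n ≠ 0` is trivial (`Ẑ` is torsion-free: `ZHatCompletion.eq_one_of_pow_eq_one`);
* the torsion element: abc-iut-w5-d062's `GalSect.toKxHat_neg_one_ne_one` (`GalSectKxHatInjective`, p455221: `K^× ↪ (K^×)^∧` by
  abc-iut-L4's `eta_units_injective`) — `η(−1) ∈ (K^×)^∧` is a non-trivial element of order `2` (`toKxHat_neg_one_sq`);
* **`GalSect.CuspPair.isEmpty_kxHat_mulEquiv_resKer_of_conj_eq`** — at a pair with central `I ≅ Ẑ` there is NO group isomorphism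
  `(K^×)^∧ ≃* Ker(res)` (torsion vs. torsion-free), whatever the base field;
* **`MuTwoSetting.DotCCusp.not_isGenuineTorsor_of_conj_eq`** — a cusp datum whose pair has central inertia (and a splitting) NEVER
  satisfies clause (2);
* at abc-iut-L2-t10's commutator-axis Krull carrier: `SettingModel.conj_eq_of_mem_pairInvκ'` (the pushed pair `(inclX D_x, inclX I_x)`
  has central inertia), **`SettingModel.isEmpty_structureGroupIso_inversionModelκ'`** (the input (d′) of `dotCCuspκ'OfStructureGroupIso`,
  p454786, is EMPTY — the hypothesis of `exists_isGenuineTorsor_inversionModelκ'_of_structureGroupIso` is unsatisfiable) and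
  **`SettingModel.not_isGenuineTorsor_dotCCuspκ'OfTrivialisation`** (for EVERY trivialisation `eK`, the p447306 output fails (gen)).

CENSUS TOKEN (row `MuTwoSetting.DotCCusp`, C7e (2)): at the commutator-axis carrier NO `DotCCusp` over the pair `(D_x, I_x)` meets
(gen) — the untwisted inertia makes `Ker(res) = Hom_cont(G_{ℚ_p}, Ẑ)` torsion-free while `(ℚ_pˣ)^∧ ⊇ μ₂`; at the `b`-axis carriers
`DotCCusp` is empty outright (p443644/p445383).  With clause (1) (`GalSectCuspCyclotomicInertia`, p452745): both C7e clauses have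
NO producer in the zoo; the joint target is GAP row G-L2t5-1 («CuspTwistAction»).  HONEST FRAMING: classical group theory and local
fields; semi-synthetic models are consistency evidence only; nothing of [EtTh]/[GalSect] asserted; no side taken on [IUTchIII]
Cor. 3.12; typed ≠ proved.
-/

noncomputable section

namespace Literature.AnabelianGeometry.EtaleTheta

open Literature.AnabelianGeometry.SemiGraphs _root_.Topology
open scoped Pointwise IsMulCommutative

/-! ### §1. `H¹(H, A)` is torsion-free for a trivial action on torsion-free coefficients -/

namespace ContH1

variable {G G' : Type*} [Group G] [TopologicalSpace G] [Group G'] [TopologicalSpace G'] [IsTopologicalGroup G']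
  {φ : G →* G'} {A : Subgroup G'} [A.Normal] [IsMulCommutative A] {H : Subgroup G}

/-- **`H¹(H, A)` is torsion-free when `H` acts trivially (through `φ`) on the torsion-free abelian `A`**: a class `x` with `xⁿ = 1`,
`n ≠ 0`, is trivial — its cocycle `f` is a homomorphism with `f(h)ⁿ` a coboundary value, i.e. `1`.
[cite: NeukirchSchmidtWingberg2008, I §2 and II §7] -/
theorem eq_one_of_pow_eq_one_of_conjNormal_eq (hcen : ∀ (h : H) (a : A), MulAut.conjNormal (φ (h : G)) a = a)
    (htf : ∀ (a : A) (n : ℕ), n ≠ 0 → a ^ n = 1 → a = 1) (x : ContH1 φ A H) {n : ℕ} (hn : n ≠ 0) (hx : x ^ n = 1) :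
    x = 1 := by
  induction x using QuotientGroup.induction_on with
  | H f =>
    have hfn : (QuotientGroup.mk (f ^ n) :
        contCocycles φ A H ⧸ (contCoboundaries φ A H).subgroupOf (contCocycles φ A H)) = 1 := hx
    rw [QuotientGroup.eq_one_iff, Subgroup.mem_subgroupOf] at hfn
    obtain ⟨a, ha⟩ := (mem_contCoboundaries_iff _).mp hfn
    change (QuotientGroup.mk f : contCocycles φ A H ⧸ (contCoboundaries φ A H).subgroupOf (contCocycles φ A H)) = 1
    rw [QuotientGroup.eq_one_iff, Subgroup.mem_subgroupOf]
    refine (mem_contCoboundaries_iff _).mpr ⟨1, ?_⟩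
    funext h
    have hh : (f.1 h) ^ n = 1 := by
      have h1 := congrFun ha h
      rw [hcen h a, mul_inv_cancel] at h1
      rw [← h1]
      rfl
    rw [htf _ n hn hh, hcen h 1, inv_one, mul_one]

end ContH1

/-! ### §2. Cuspidal pairs with central inertia `I ≅ Ẑ`: `H¹(D, I)` is torsion-free -/

namespace GalSect

namespace CuspPair

variable {Γ : Type*} [Group Γ] [TopologicalSpace Γ] [IsTopologicalGroup Γ] (P : CuspPair Γ)

omit [IsTopologicalGroup Γ] in
/-- If `I ≅ Ẑ` (as groups) then `I` — and `I` seen inside `↥D` — is torsion-free. [cite: MochizukiGalSect2005, §4 p.33] -/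
theorem ID_eq_one_of_pow_eq_one (e : P.I ≃* ZHat) (a : P.ID) (n : ℕ) (hn : n ≠ 0) (ha : a ^ n = 1) : a = 1 := by
  have hI : ((a : P.D) : Γ) ∈ P.I := a.2
  have h1 : (⟨((a : P.D) : Γ), hI⟩ : P.I) ^ n = 1 := by
    apply Subtype.ext
    have := congrArg (fun b : P.ID => (((b : P.D)) : Γ)) ha
    simpa using this
  have h2 : e ⟨((a : P.D) : Γ), hI⟩ = 1 :=
    Literature.AnabelianGeometry.AbsoluteAnabelian.ZHatCompletion.eq_one_of_pow_eq_one hn (by rw [← map_pow, h1, map_one])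
  have h3 : (⟨((a : P.D) : Γ), hI⟩ : P.I) = 1 := e.injective (by rw [h2, map_one])
  apply Subtype.ext; apply Subtype.ext
  exact congrArg (fun b : P.I => (b : Γ)) h3

/-- **`H¹(D, I)` is torsion-free at a pair with CENTRAL inertia `I ≅ Ẑ`** (e.g. the commutator-axis cusp of every untwisted carrier).
[cite: NeukirchSchmidtWingberg2008, I §2 and II §7] -/
theorem contH1_eq_one_of_pow_eq_one [IsMulCommutative P.I] (hcomm : ∀ d ∈ P.D, ∀ i ∈ P.I, d * i * d⁻¹ = i) (e : P.I ≃* ZHat)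
    (x : haveI := P.ID_normal; ContH1 (MonoidHom.id P.D) P.ID (⊤ : Subgroup P.D)) {n : ℕ} (hn : n ≠ 0)
    (hx : haveI := P.ID_normal; x ^ n = 1) :
    haveI := P.ID_normal; x = 1 := by
  haveI := P.ID_normal
  refine ContH1.eq_one_of_pow_eq_one_of_conjNormal_eq (fun h a => ?_) (fun a n hn ha => P.ID_eq_one_of_pow_eq_one e a n hn ha)
    x hn hx
  apply Subtype.ext; apply Subtype.ext
  rw [MulAut.conjNormal_apply, MonoidHom.id_apply]
  change ((h : P.D) : Γ) * ((a : P.D) : Γ) * ((h : P.D) : Γ)⁻¹ = ((a : P.D) : Γ)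
  exact hcomm _ (h : P.D).2 _ a.2

end CuspPair

/-! ### §3. `K^× ↪ (K^×)^∧`: the element `η(−1)` of order `2` -/

variable {p : ℕ} [Fact p.Prime]

/-- `η(−1)² = 1`. [cite: MochizukiGalSect2005, §4 p.33] -/
theorem toKxHat_neg_one_sq (X : TemperedCurve p) : toKxHat X (-1) ^ 2 = 1 := by
  rw [← map_pow, neg_one_sq, map_one]

namespace CuspPair

variable {Γ : Type*} [Group Γ] [TopologicalSpace Γ] [IsTopologicalGroup Γ]

/-- **No identification of structure groups at central inertia**: for a cuspidal pair `(D, I)` in any topological group with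
`I ≅ Ẑ` central in `D`, and any base splitting, there is NO group isomorphism `(K^×)^∧ ≃* Ker(res : H¹(D, I) → H¹(I, I))` (`K` the base
field of any tempered curve): `η(−1)` has order `2`, `Ker(res) ⊆ H¹(D, I)` is torsion-free. [cite: MochizukiGalSect2005, §4 p.33] -/
theorem isEmpty_kxHat_mulEquiv_resKer_of_conj_eq (X : TemperedCurve p) (P : CuspPair Γ) [IsMulCommutative P.I]
    (hcomm : ∀ d ∈ P.D, ∀ i ∈ P.I, d * i * d⁻¹ = i) (e : P.I ≃* ZHat) {S₀ : Subgroup Γ} (hS₀ : S₀ ∈ P.splittings) :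
    haveI := P.ID_normal
    IsEmpty (KxHat X ≃* ↥(ContH1.resKer P.ID (⊤ : Subgroup P.D) (P.isClosedComplement_of_mem_splittings hS₀).le_left)) := by
  haveI := P.ID_normal
  refine ⟨fun κ => toKxHat_neg_one_ne_one X ?_⟩
  have h1 : (κ (toKxHat X (-1))) ^ 2 = 1 := by rw [← map_pow, toKxHat_neg_one_sq, map_one]
  have h2 : ((κ (toKxHat X (-1)) : ContH1 (MonoidHom.id P.D) P.ID (⊤ : Subgroup P.D))) ^ 2 = 1 := by
    rw [← Subgroup.coe_pow, h1, Subgroup.coe_one]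
  have h3 := P.contH1_eq_one_of_pow_eq_one hcomm e _ two_ne_zero h2
  have h4 : κ (toKxHat X (-1)) = 1 := Subtype.ext h3
  exact κ.injective (by rw [h4, map_one])

end CuspPair

end GalSect

/-! ### §4. [EtTh] Thm. 1.10 (iii)'s cusp datum: clause (2) FAILS at central inertia -/

namespace MuTwoSetting.DotCCusp

open GalSect

variable {p : ℕ} [Fact p.Prime] {M : MuTwoSetting p} {εZ : M.GtpC}

/-- **A cusp datum whose pair has CENTRAL inertia (and a splitting) never meets C7e clause (2)** (`IsGenuineTorsor`, = the v3 binder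
(gen)): there is no `κ : (K^×)^∧ ≃* Ker(res)` at all. [cite: MochizukiEtTh2009, Thm 1.10 (iii) p.30] -/
theorem not_isGenuineTorsor_of_conj_eq [T1Space M.GtpC] (C : M.DotCCusp εZ)
    (hcomm : ∀ d ∈ C.pair.D, ∀ i ∈ C.pair.I, d * i * d⁻¹ = i) {S₀ : Subgroup M.GtpC} (hS₀ : S₀ ∈ C.pair.splittings) :
    ¬ C.IsGenuineTorsor := by
  intro h
  haveI := C.isMulCommutative_I
  obtain ⟨κ, -⟩ := h hS₀
  exact (CuspPair.isEmpty_kxHat_mulEquiv_resKer_of_conj_eq M.toThetaSetting.toTemperedCurve C.pair hcomm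
    C.inertia_equiv_zHat.some.toMulEquiv hS₀).false κ

end MuTwoSetting.DotCCusp

/-! ### §5. The commutator-axis Krull carrier `inversionModelκ′`: (d′) and (gen) are EMPTY -/

namespace SettingModel

open GalSect MuTwoSetting

variable (p : ℕ) [Fact p.Prime]

/-- **The pushed commutator-axis pair has CENTRAL inertia**: `inclX(D_x) = inclX(c^Ẑ × G_{ℚ_p})` centralises `inclX(I_x) = inclX(c^Ẑ)`
(`conj_eq_of_mem_inertia_curveκ'`, p452745, pushed along the homomorphism `inclX`). [cite: MochizukiEtTh2009, §1 p.13] -/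
theorem conj_eq_of_mem_pairInvκ' {d i : (MuTwoSetting.inversionModelκ' p).GtpC} (hd : d ∈ (pairInvκ' p).D) (hi : i ∈ (pairInvκ' p).I) :
    d * i * d⁻¹ = i := by
  obtain ⟨d₀, hd₀, rfl⟩ := hd
  obtain ⟨i₀, hi₀, rfl⟩ := hi
  rw [← map_mul, ← map_inv, ← map_mul, conj_eq_of_mem_inertia_curveκ' p hd₀ hi₀]

/-- **The input (d′) of `dotCCuspκ'OfStructureGroupIso` (p454786) is EMPTY**: there is NO identification of structure groups
`(ℚ_pˣ)^∧ ≃* Ker(res)` for the pushed commutator-axis pair of `inversionModelκ′` — so the hypothesis of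
`exists_isGenuineTorsor_inversionModelκ'_of_structureGroupIso` is unsatisfiable at this untwisted carrier. [cite: MochizukiEtTh2009, Thm 1.10 (iii) p.30] -/
theorem isEmpty_structureGroupIso_inversionModelκ' :
    haveI := isMulCommutative_pairInvκ'_I p
    haveI := (pairInvκ' p).ID_normal
    IsEmpty (KxHat (curveκ' p) ≃* ↥(ContH1.resKer (pairInvκ' p).ID (⊤ : Subgroup (pairInvκ' p).D)
      ((pairInvκ' p).isClosedComplement_of_mem_splittings (map_inclInvκ_inr_mem_splittings p)).le_left)) :=
  haveI := isMulCommutative_pairInvκ'_I p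
  CuspPair.isEmpty_kxHat_mulEquiv_resKer_of_conj_eq (curveκ' p) (pairInvκ' p) (fun _ hd _ hi => conj_eq_of_mem_pairInvκ' p hd hi)
    ((cuspPairOf (curveκ' p) ()).inertiaEquivPushforward (MuTwoSetting.inversionModelκ' p).continuous_inclX
      ((MuTwoSetting.inversionModelκ' p).isClosedEmbedding_inclX (cLevelDataInvκ' p)).isEmbedding
      ((curveκ' p).inertia_equiv_zHat () trivial).some).toMulEquiv
    (map_inclInvκ_inr_mem_splittings p)

/-- **For EVERY trivialisation `eK` the p447306 output `dotCCuspκ'OfTrivialisation p εZ eK` FAILS C7e clause (2)** (the v3 binder (gen)):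
its pair is the pushed commutator-axis pair, whose inertia is central. [cite: MochizukiEtTh2009, Thm 1.10 (iii) p.30] -/
theorem not_isGenuineTorsor_dotCCuspκ'OfTrivialisation (εZ : (MuTwoSetting.inversionModelκ' p).GtpC)
    (eK : ((cuspPairOf (curveκ' p) ()).pushforward (inclInvκ p)).SplittingClass ≃ KxHat (curveκ' p)) :
    haveI := t1Space_GtpC_inversionModelκ' p
    ¬ (dotCCuspκ'OfTrivialisation p εZ eK).IsGenuineTorsor :=
  haveI := t1Space_GtpC_inversionModelκ' p
  DotCCusp.not_isGenuineTorsor_of_conj_eq _ (fun _ hd _ hi => conj_eq_of_mem_pairInvκ' p hd hi)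
    (map_inclInvκ_inr_mem_splittings p)

/-- The two C7e clauses side by side at the commutator-axis carrier, for the p447306 producer and every `eK`, `ε_Z`: NEITHER cyclotomic
inertia (clause (1), p452745) NOR the genuine torsor (clause (2)). [cite: MochizukiEtTh2009, Thm 1.10 (iii) p.30] -/
theorem not_isCyclotomicInertia_and_not_isGenuineTorsor_dotCCuspκ'OfTrivialisation
    (εZ : (MuTwoSetting.inversionModelκ' p).GtpC)
    (eK : ((cuspPairOf (curveκ' p) ()).pushforward (inclInvκ p)).SplittingClass ≃ KxHat (curveκ' p)) :
    haveI := t1Space_GtpC_inversionModelκ' p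
    ¬ (dotCCuspκ'OfTrivialisation p εZ eK).IsCyclotomicInertia ∧ ¬ (dotCCuspκ'OfTrivialisation p εZ eK).IsGenuineTorsor :=
  ⟨not_isCyclotomicInertia_dotCCuspκ'OfTrivialisation p εZ eK, not_isGenuineTorsor_dotCCuspκ'OfTrivialisation p εZ eK⟩

end SettingModel

end Literature.AnabelianGeometry.EtaleTheta

end
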